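import Summits.Ventures.HodgeRepro2.T5SU11KernelDerivative
import Summits.Ventures.HodgeRepro2.T5SU11ResolventPowerSeriesGroundState

/-!
# The power series of the kernel in the spectral parameter: `K_λ = Σ_k (μ − μ₂)^k K_{λ₂}^{∘(k+1)}` on the sharp disc

The kernel source `k_s = K_{λ₂}(·, s)` lies in `W_1` (row 575), so row 559's Neumann power series of the resolvent applies to
it: `G^I_λ k_s(t) = Σ_k (μ − μ₂)^k (G^I_{λ₂})^{k+1} k_s(t)` for `|μ − μ₂| < (λ₂ − 1)²`. Since
`K_λ(t, s) = K_{λ₂}(t, s) + (μ − μ₂) G^I_λ k_s(t)` (row 5xx's kernel resolvent identity) and `(G^I_{λ₂})^k k_s(t)` is the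
`(k+1)`-fold composed kernel `K_{λ₂}^{∘(k+1)}(t, s)` (`k = 0`: the kernel; `k = 1`: `K ∘ K`, row 575), this reads:

* `hasSum_kernel_neumann`, `tsum_kernel_neumann` — **`K_λ(t, s) = Σ_{k ≥ 0} (μ − μ₂)^k · (G^I_{λ₂})^k K_{λ₂}(·, s)(t)`**
  for `|μ − μ₂| < (λ₂ − 1)²`, `t, s > 0`: the kernel is the sum of its Neumann series in the spectral parameter — row 511's
  kernel resolvent identity iterated to all orders, with the sharp radius `dist(μ₂, −ρ²)`;
* `summable_kernel_neumann` — the series is absolutely summable.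

Nothing is claimed about (N).

Blind lane: Mathlib + the HodgeRepro2 prefix only; no sorry; axioms ⊆ {propext, Classical.choice,
Quot.sound}.
-/

namespace Summit.Ventures.HodgeRepro2.T5SU11KernelPowerSeries

open Filter Topology MeasureTheory
open Set (Ioi Ioc)
open T5SU11Cartan T5SU11SphericalFunction T5SU11SphericalDecay T5SU11RadialGreenKernel T5SU11RadialGreenImproper
  T5SU11KernelDifferenceRegularity T5SU11KernelDerivative T5SU11ResolventPowerSeriesGroundState

section measure

variable [MeasurableSpace Circle] [BorelSpace Circle]

variable {lam lam₂ : ℝ} (hlam : 1 < lam) (hlam₂ : 1 < lam₂) {s : ℝ} (hs : 0 < s)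

include hlam₂ hs in
/-- **The kernel's Neumann series is absolutely summable** on the sharp disc, at every `t > 0`. -/
theorem summable_kernel_neumann (hq : |lam * (lam - 2) - lam₂ * (lam₂ - 2)| < (lam₂ - 1) ^ 2) {t : ℝ} (ht : 0 < t) :
    Summable (fun k : ℕ => (lam * (lam - 2) - lam₂ * (lam₂ - 2)) ^ k
      * ((greenSolI (fun t => sph lam₂ (hyp t)) (sphDecay lam₂))^[k] (fun r => sphGreenKernel lam₂ r s)) t) := by
  obtain ⟨D, _, hD⟩ := kernel_source_mem_weighted_one hlam₂ hs
  have hg := kernel_source_continuousOn hlam₂ hs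
  have h := summable_neumann_weighted_one (lam := lam) hlam₂ hg hD hq ht
  -- shift the index: the series with the `k = 0` term prepended
  rw [← summable_nat_add_iff 1]
  refine (h.mul_left (lam * (lam - 2) - lam₂ * (lam₂ - 2))).congr (fun k => ?_)
  rw [pow_succ]
  ring

include hlam hlam₂ hs in
/-- **THE KERNEL IS THE SUM OF ITS NEUMANN SERIES IN THE SPECTRAL PARAMETER**: for `|μ − μ₂| < (λ₂ − 1)²` and `t > 0`,
`HasSum (fun k => (μ − μ₂)^k · (G^I_{λ₂})^k K_{λ₂}(·, s)(t)) (K_λ(t, s))`. -/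
theorem hasSum_kernel_neumann (hq : |lam * (lam - 2) - lam₂ * (lam₂ - 2)| < (lam₂ - 1) ^ 2) {t : ℝ} (ht : 0 < t) :
    HasSum (fun k : ℕ => (lam * (lam - 2) - lam₂ * (lam₂ - 2)) ^ k
      * ((greenSolI (fun t => sph lam₂ (hyp t)) (sphDecay lam₂))^[k] (fun r => sphGreenKernel lam₂ r s)) t)
      (sphGreenKernel lam t s) := by
  obtain ⟨D, _, hD⟩ := kernel_source_mem_weighted_one hlam₂ hs
  have hg := kernel_source_continuousOn hlam₂ hs
  set κ := lam * (lam - 2) - lam₂ * (lam₂ - 2) with hκ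
  -- row 559 on the kernel source, multiplied by `μ − μ₂`
  have h := (hasSum_neumann_weighted_one hlam hlam₂ hg hD hq ht).mul_left κ
  -- the shifted series
  have hshift : HasSum (fun k : ℕ => κ ^ (k + 1)
      * ((greenSolI (fun t => sph lam₂ (hyp t)) (sphDecay lam₂))^[k + 1] (fun r => sphGreenKernel lam₂ r s)) t)
      (κ * greenSolI (fun t => sph lam (hyp t)) (sphDecay lam) (fun r => sphGreenKernel lam₂ r s) t) := by
    refine h.congr_fun (fun k => ?_)
    rw [pow_succ]
    ring
  -- `K_λ(t, s) = K_{λ₂}(t, s) + (μ − μ₂) G^I_λ k_s(t)` (the `k = 0` term is `K_{λ₂}(t, s)`)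
  have hK : sphGreenKernel lam t s
      = κ * greenSolI (fun t => sph lam (hyp t)) (sphDecay lam) (fun r => sphGreenKernel lam₂ r s) t
        + sphGreenKernel lam₂ t s := by
    rcases eq_or_ne lam lam₂ with heq | hne
    · subst heq
      simp [hκ]
    · have hμne : κ ≠ 0 := by
        have e : κ = (lam - lam₂) * (lam + lam₂ - 2) := by rw [hκ]; ring
        rw [e]
        exact mul_ne_zero (sub_ne_zero.mpr hne) (by linarith)
      rw [greenSolI_kernel_eq hlam hlam₂ hs hne ht, ← hκ, mul_div_cancel₀ _ hμne]
      ring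
  refine (hasSum_nat_add_iff' 1).mp ?_
  rw [Finset.sum_range_one]
  simp only [pow_zero, one_mul, Function.iterate_zero, id]
  have e : sphGreenKernel lam t s - sphGreenKernel lam₂ t s
      = κ * greenSolI (fun t => sph lam (hyp t)) (sphDecay lam) (fun r => sphGreenKernel lam₂ r s) t := by
    rw [hK]; ring
  rw [e]
  exact hshift

include hlam hlam₂ hs in
/-- **`∑' k, (μ − μ₂)^k · (G^I_{λ₂})^k K_{λ₂}(·, s)(t) = K_λ(t, s)`** on the sharp disc. -/
theorem tsum_kernel_neumann (hq : |lam * (lam - 2) - lam₂ * (lam₂ - 2)| < (lam₂ - 1) ^ 2) {t : ℝ} (ht : 0 < t) :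
    ∑' k : ℕ, (lam * (lam - 2) - lam₂ * (lam₂ - 2)) ^ k
      * ((greenSolI (fun t => sph lam₂ (hyp t)) (sphDecay lam₂))^[k] (fun r => sphGreenKernel lam₂ r s)) t
      = sphGreenKernel lam t s :=
  (hasSum_kernel_neumann hlam hlam₂ hs hq ht).tsum_eq

end measure

end Summit.Ventures.HodgeRepro2.T5SU11KernelPowerSeries
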